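import Literature.Computability.Cryptography.RegevReductionCVPqProgPost
import Literature.Computability.Cryptography.RegevReductionFloorGaussianSampler
import HarnessLib

/-!
# Regev 2009, Lemma 3.11 — the programs of the `CVP_q` machine exist: A_plumb PROVED

Topic `Computability/Cryptography` (family `pqc`); the last module of the polynomial-time realisation of
the classical part of Regev's quantum step (`RegevReductionCVPqProgParse` 8a, `…ProgBlock` 8b,
`…ProgManuf` 8c, `…ProgPost` 8d). `RegevReductionCVPqProgramsAssembly` reduced the named fact
`regev2009_lemma_3_11_cvpqPlumbing q α` (**A_plumb**: the `CVP_q` procedure of Lemma 3.11 is ONE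
polynomial-time oracle machine around the LWE circuit family) to `Nonempty (CVPqPrograms q α m a samp pc W)`:
two `FP` string functions — the block manufacture (8c, `CVPqProg.exists_manuf`) and the post-processing
(8d, `CVPqProg.exists_post`) — with two polynomials, `pK` (number of parallel blocks) and `pcoin` (coins
per block). THIS FILE supplies the polynomials and assembles the structure:

* `CVPqProg.exists_pK`: `nBlk m n ≤ pK(|x|) + 1`, read off the output length of the `FP` program that
  computes the number of blocks `(24 m(n) + 2)(n + 1)` IN UNARY from the query `x`
  (`exists_poly_length_le_of_mem_FP`);
* `CVPqProg.coinsP`, `coinsP_blockParams`, `codeFP_coinsP`, `coinsL`, `coinsL_qOf`, `codeFP_coinsL`,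
  `CVPqProg.exists_pcoin`: every block's coin count `ℓ_U n + L_c m + L_f N_V` (`blockCoins`) is an item of
  a unary list an `FP` program writes from the query, hence at most `pcoin(|x|) ≤ pcoin(|x ++ e_j|)`;
* **`Regev2009.cvpqPrograms_nonempty`** and **`regev2009_lemma_3_11_cvpqPlumbing_holds :
  regev2009_lemma_3_11_cvpqPlumbing q α`** — A_plumb is a theorem (standard axioms);
* consequences with the tree's `RegevReductionFloorGaussianSampler` (A_gsamp proved there):
  `regev2009_lemma_3_11_cvpqMachine_holds` (A_cvpqM, the classical half of the quantum step, is now a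
  theorem outright), `regev_lwe_to_sivp_quantum_holds_of_stepFamily`, `regev_lwe_to_gapSVP_quantum_holds_of_stepFamily`
  — Regev's Theorem 3.1 (`pqc.S19`, both forms) from the SINGLE remaining named fact
  `regev2009_lemma_3_14_stepFamily q α` (A_q14, the uniform quantum circuit family of Lemma 3.14).

No new named fact is introduced; nothing is restated. HONEST FRAMING: the value is a THEOREM — the
kernel-checked existence, in `FP`, of the classical programs of a KNOWN reduction, discharging one
precisely typed residual; the trust base of `pqc.S19` shrinks from {A_plumb, A_q14} to {A_q14}. It is NOT
progress on any summit and breaks nothing.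

References. O. Regev, *On lattices, learning with errors, random linear codes, and cryptography*, J. ACM
56 (2009), art. 34; pages from the author's version arXiv:2401.03703: Lemma 3.11 p. 18 (proof: the
procedure is efficient), Lemma 3.7 p. 16, §3.2.1 p. 15, Theorem 3.1 p. 13, Lemma 3.14 p. 20. Arora–Barak
2009, §1.3 (output length of polynomial-time functions; closure under composition).
Bennett–Bernstein–Brassard–Vazirani 1997, Thm. 4.14 (parallel copies with classical pre/post-processing).
-/

noncomputable section

namespace Literature.Computability.Cryptography

namespace Regev2009

namespace CVPqProg

open _root_.Computability Literature.Computability.Complexity Literature.Computability.Complexity.CodeFP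
  Literature.Computability.Complexity.Brick Literature.Algebra.EuclideanLattices Polynomial Finset
  Peikert2009 LWE DigitOracle

/-! ### Unary size parameters read off the query data -/

/-- The dimension `n`, in unary, off the query data. [cite: AroraBarak2009, §1.3] -/
theorem codeFP_qDim : CodeFP qE unE (fun d => d.1.1.1.n) :=
  (GapCodes.svpNUn_codeFP.comp (fst _ _).fst' :)

/-- The number of samples `m(n)`, in unary (it is polynomially bounded), off the query data.
[cite: AroraBarak2009, §1.3] -/
theorem codeFP_qSamples {m : ℕ → ℕ} (hm : PolyTimeComputable unaryEncodeNat encodeNat m) (hpm : IsPolyBounded m) :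
    CodeFP qE unE (fun d => m d.1.1.1.n) := by
  obtain ⟨pm, hpm'⟩ := id hpm
  exact (unOfNatMin.comp (((codePolyLenU unE pm).comp codeFP_qDim).pair ((codeFP_natParam hm).comp codeFP_qDim))).congr
    fun d => by simpa using (min_eq_left (hpm' d.1.1.1.n)).symm

/-- The number of blocks `(24 m(n) + 2)(n + 1)`, in unary, off the query data. [cite: AroraBarak2009, §1.3] -/
theorem codeFP_qBlocks {m : ℕ → ℕ} (hm : PolyTimeComputable unaryEncodeNat encodeNat m) (hpm : IsPolyBounded m) :
    CodeFP qE unE (fun d => nBlkN m d.1.1.1.n) :=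
  ((_root_.Literature.Computability.QuantumComplexity.unMul_codeFP).comp
    ((unAdd.comp (((unMulConst 24).comp (codeFP_qSamples hm hpm)).pair (const _ (2 : ℕ)))).pair
      (unSucc.comp codeFP_qDim))).congr fun _ => by simp only [nBlkN]

/-! ### The copies polynomial `pK` -/

/-- **A copies polynomial exists**: `nBlk m n ≤ pK(|x|) + 1` on every query `x` of the procedure, `pK`
being an output-length polynomial of the unary block-count program. [cite: AroraBarak2009, §1.3;
RegevLWE2009, Lemma 3.11 (proof: `poly(n)` oracle calls)] -/
theorem exists_pK {m : ℕ → ℕ} (hm : PolyTimeComputable unaryEncodeNat encodeNat m) (hpm : IsPolyBounded m) :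
    ∃ pK : Polynomial ℕ, ∀ (I : LatticeInstance) (ρ : ℚ) (k : ℕ) (t : Fin I.n → ℚ) (P : ℕ) (w : Fin P → I.lattice),
      nBlk m I.n ≤ pK.eval (queryOf I ρ k t w).length + 1 := by
  obtain ⟨f, hf, hfe⟩ := codeFP_qBlocks hm hpm
  obtain ⟨pK, hpK⟩ := exists_poly_length_le_of_mem_FP hf
  refine ⟨pK, fun I ρ k t P w => le_trans ?_ (Nat.le_succ _)⟩
  have h := hpK (qE (qOf I ρ k t w))
  rw [hfe, length_unE, qE_qOf] at h
  exact h

/-! ### The coins polynomial `pcoin` -/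

/-- The coin count of a block from its parameter tuple `((q, K, n, N), (M_c, M_f, s_c, s_f), (ℓ_U, L_c, L_f))`,
the number of samples `m` and of verification pairs `N_V`: `ℓ_U·n + L_c·m + L_f·N_V`.
[cite: RegevLWE2009, Lemma 3.11 (proof) with Lemma 3.7 (proof)] -/
def coinsP (B : (ℕ × ℕ × ℕ × ℕ) × (ℕ × ℕ × ℚ × ℚ) × (ℕ × ℕ × ℕ)) (m' NV : ℕ) : ℕ :=
  B.2.2.1 * B.1.2.2.1 + B.2.2.2.1 * m' + B.2.2.2.2 * NV

/-- `coinsP` of block `j`'s parameters is the tree's `blockCoins` of block `j`. [folklore] -/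
theorem coinsP_blockParams (q : ℕ → ℕ) (m : ℕ → ℕ) (a : ℕ → ℚ) (pc : Polynomial ℕ) (I : LatticeInstance)
    (t : Fin I.n → ℚ) (j : Fin (nBlk m I.n)) :
    coinsP (blockParams pc (q I.n) (m I.n) (a I.n) I.n (denom t) j) (m I.n) (nVerify I.n) =
      blockCoins (n := I.n) (m I.n) (nVerify I.n) pc (q I.n * denom t)
        (padVar (a I.n) (nLevels (m I.n)) (schedJ I.n) j) I.n (q I.n * schedK * denom t) ((a I.n) ^ 2 / 2) I.n
        (Nat.size (q I.n) + I.n) := by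
  rw [blockParams, ← padVarQ_eq]
  rfl

/-- Input of the coin-count program: the context `(1ⁿ, N)` and `(j, ())`. [folklore] -/
abbrev cinE : (ℕ × ℕ) × (ℕ × Unit) → List Bool := pairE (pairE unE natE) (pairE natE unitE)

/-- **The coin count of block `j` is polynomial-time, in unary**, from `(1ⁿ, N, j)`.
[cite: AroraBarak2009, §1.3] -/
theorem codeFP_coinsP {q m : ℕ → ℕ} {a : ℕ → ℚ} (pc : Polynomial ℕ)
    (hq : PolyTimeComputable unaryEncodeNat encodeNat q) (hm : PolyTimeComputable unaryEncodeNat encodeNat m)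
    (hpm : IsPolyBounded m) (ha : PolyTimeComputable unaryEncodeNat encodeRat a) :
    CodeFP cinE unE (fun x => coinsP (blockParams pc (q x.1.1) (m x.1.1) (a x.1.1) x.1.1 x.1.2 x.2.1) (m x.1.1)
      (nVerify x.1.1)) := by
  obtain ⟨pm, hpm'⟩ := id hpm
  have cn : CodeFP cinE unE (fun x => x.1.1) := (fst _ _).fst'
  have cN : CodeFP cinE natE (fun x => x.1.2) := (fst _ _).snd'
  have cj : CodeFP cinE natE (fun x => x.2.1) := (snd _ _).fst'
  have cq : CodeFP cinE natE (fun x => q x.1.1) := ((codeFP_natParam hq).comp cn :)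
  have cmN : CodeFP cinE natE (fun x => m x.1.1) := ((codeFP_natParam hm).comp cn :)
  have cmU : CodeFP cinE unE (fun x => m x.1.1) :=
    (unOfNatMin.comp (((codePolyLenU unE pm).comp cn).pair cmN)).congr fun x => by
      simpa using (min_eq_left (hpm' x.1.1)).symm
  have cNVU : CodeFP cinE unE (fun x => nVerify x.1.1) :=
    ((unMulConst 2).comp ((unMulConst 800000).comp (unSucc.comp cn))).congr fun x => by rw [nVerify_eq]
  have ca : CodeFP cinE encodeRat (fun x => a x.1.1) := ((ofPolyTimeComputable_unE ha).comp cn :)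
  have cpar : CodeFP cinE bparE (fun x => blockParams pc (q x.1.1) (m x.1.1) (a x.1.1) x.1.1 x.1.2 x.2.1) :=
    ((codeFP_blockParams pc).comp ((cq.pair (cmN.pair ca)).pair (cn.pair (cN.pair cj))) :)
  exact (unAdd.comp ((unAdd.comp
      (((_root_.Literature.Computability.QuantumComplexity.unMul_codeFP).comp
        (cpar.snd'.snd'.fst'.pair cpar.fst'.snd'.snd'.fst')).pair
      ((_root_.Literature.Computability.QuantumComplexity.unMul_codeFP).comp (cpar.snd'.snd'.snd'.fst'.pair cmU)))).pair
    ((_root_.Literature.Computability.QuantumComplexity.unMul_codeFP).comp (cpar.snd'.snd'.snd'.snd'.pair cNVU)))).congr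
    fun _ => by simp only [coinsP]

/-- **The list of all blocks' coin counts** off the query data. [cite: RegevLWE2009, Lemma 3.11 (proof)] -/
def coinsL (pc : Polynomial ℕ) (q m : ℕ → ℕ) (a : ℕ → ℚ) (d : QData) : List ℕ :=
  (List.replicate (nBlkN m d.1.1.1.n) ()).mapIdx fun j _ =>
    coinsP (blockParams pc (q d.1.1.1.n) (m d.1.1.1.n) (a d.1.1.1.n) d.1.1.1.n (denomL d.2) j) (m d.1.1.1.n)
      (nVerify d.1.1.1.n)

/-- On the procedure's query data the list is the blocks' `blockCoins`. [folklore] -/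
theorem coinsL_qOf (q : ℕ → ℕ) (m : ℕ → ℕ) (a : ℕ → ℚ) (pc : Polynomial ℕ) (I : LatticeInstance) (ρ : ℚ) (k : ℕ)
    (t : Fin I.n → ℚ) {P : ℕ} (w : Fin P → I.lattice) :
    coinsL pc q m a (qOf I ρ k t w) = List.ofFn fun j : Fin (nBlk m I.n) =>
      blockCoins (n := I.n) (m I.n) (nVerify I.n) pc (q I.n * denom t)
        (padVar (a I.n) (nLevels (m I.n)) (schedJ I.n) j) I.n (q I.n * schedK * denom t) ((a I.n) ^ 2 / 2) I.n
        (Nat.size (q I.n) + I.n) := by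
  show ((List.replicate (nBlk m I.n) ()).mapIdx fun j _ =>
      coinsP (blockParams pc (q I.n) (m I.n) (a I.n) I.n (denomL (List.ofFn t)) j) (m I.n) (nVerify I.n)) = _
  rw [denomL_ofFn, ← List.ofFn_const, mapIdx_ofFn]
  exact congrArg List.ofFn (funext fun j => coinsP_blockParams q m a pc I t j)

/-- **The coin-count list is polynomial-time** (unary items) from the query. [cite: AroraBarak2009, §1.3] -/
theorem codeFP_coinsL {q m : ℕ → ℕ} {a : ℕ → ℚ} (pc : Polynomial ℕ)
    (hq : PolyTimeComputable unaryEncodeNat encodeNat q) (hm : PolyTimeComputable unaryEncodeNat encodeNat m)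
    (hpm : IsPolyBounded m) (ha : PolyTimeComputable unaryEncodeNat encodeRat a) :
    CodeFP qE (rawE unE) (coinsL pc q m a) := by
  have hD : CodeFP qE natE (fun d => denomL d.2) := (codeFP_denomL.comp ((rawOfList encodeRat).comp (snd _ _)) :)
  have hrep : CodeFP qE (rawE unitE) (fun d => List.replicate (nBlkN m d.1.1.1.n) ()) :=
    (replicateUnit.comp (codeFP_qBlocks hm hpm) :)
  exact ((mapIdx (σ := ℕ × ℕ) (α := Unit) (β := ℕ) (eσ := pairE unE natE) (eα := unitE) (eβ := unE)
      (g := fun x => coinsP (blockParams pc (q x.1.1) (m x.1.1) (a x.1.1) x.1.1 x.1.2 x.2.1) (m x.1.1) (nVerify x.1.1))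
      (codeFP_coinsP pc hq hm hpm ha)).comp ((codeFP_qDim.pair hD).pair hrep)).congr fun _ => rfl

/-- **A coins polynomial exists**: block `j`'s coin count is at most `pcoin(|x| + (pK(|x|) + 1))`, `pcoin`
being an output-length polynomial of the coin-count list program (each unary item is shorter than the
list's code) and monotone. [cite: AroraBarak2009, §1.3; RegevLWE2009, Lemma 3.11 (proof)] -/
theorem exists_pcoin (q : ℕ → ℕ) (m : ℕ → ℕ) (a : ℕ → ℚ) (pc : Polynomial ℕ)
    (hq : PolyTimeComputable unaryEncodeNat encodeNat q) (hm : PolyTimeComputable unaryEncodeNat encodeNat m)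
    (hpm : IsPolyBounded m) (ha : PolyTimeComputable unaryEncodeNat encodeRat a) (pK : Polynomial ℕ) :
    ∃ pcoin : Polynomial ℕ, ∀ (I : LatticeInstance) (ρ : ℚ) (k : ℕ) (t : Fin I.n → ℚ) (P : ℕ) (w : Fin P → I.lattice)
      (j : Fin (nBlk m I.n)),
      blockCoins (n := I.n) (m I.n) (nVerify I.n) pc (q I.n * denom t)
          (padVar (a I.n) (nLevels (m I.n)) (schedJ I.n) j) I.n (q I.n * schedK * denom t) ((a I.n) ^ 2 / 2) I.n
          (Nat.size (q I.n) + I.n) ≤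
        pcoin.eval ((queryOf I ρ k t w).length + (pK.eval (queryOf I ρ k t w).length + 1)) := by
  obtain ⟨f, hf, hfe⟩ := codeFP_coinsL pc hq hm hpm ha
  obtain ⟨pcoin, hpc⟩ := exists_poly_length_le_of_mem_FP hf
  refine ⟨pcoin, fun I ρ k t P w j => ?_⟩
  have hmem : blockCoins (n := I.n) (m I.n) (nVerify I.n) pc (q I.n * denom t)
      (padVar (a I.n) (nLevels (m I.n)) (schedJ I.n) j) I.n (q I.n * schedK * denom t) ((a I.n) ^ 2 / 2) I.n
      (Nat.size (q I.n) + I.n) ∈ coinsL pc q m a (qOf I ρ k t w) := by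
    rw [coinsL_qOf]
    exact List.mem_ofFn.2 ⟨j, rfl⟩
  have h1 := length_item_le_length_rawE unE hmem
  rw [length_unE, ← hfe (qOf I ρ k t w), qE_qOf] at h1
  have h2 := hpc (qE (qOf I ρ k t w))
  rw [qE_qOf] at h2
  have h3 := TM2Iter.eval_mono pcoin
    (Nat.le_add_right (queryOf I ρ k t w).length (pK.eval (queryOf I ρ k t w).length + 1))
  omega

end CVPqProg

/-! ### The programs exist -/

open _root_.Computability Literature.Computability.Complexity Literature.Computability.QuantumComplexity
  Literature.Algebra.EuclideanLattices LWE in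
/-- **The four programs of Regev's `CVP_q` machine exist**: the copies polynomial, the coins polynomial,
the block manufacture (`CVPqProg.exists_manuf`) and the post-processing (`CVPqProg.exists_post`), with
their specifications. [cite: RegevLWE2009, Lemma 3.11 (proof), Lemma 3.7 (proof), §3.2.1;
BennettBernsteinBrassardVazirani1997, Thm. 4.14; AroraBarak2009, §1.3] -/
theorem cvpqPrograms_nonempty (q : ℕ → ℕ) [∀ n, NeZero (q n)] (α : ℕ → ℝ) (m : ℕ → ℕ) (hpm : IsPolyBounded m)
    (hqm : IsPolyTimeParams q α m) (a : ℕ → ℚ) (hαa : ∀ n, α n = a n)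
    (ha : PolyTimeComputable unaryEncodeNat encodeRat a) (samp : List Bool → List Bool) (pc : Polynomial ℕ)
    (hsamp : samp ∈ FP) (W : UniformQCircuitFamily) : Nonempty (CVPqPrograms q α m a samp pc W) := by
  obtain ⟨hq, hm, -⟩ := hqm
  obtain ⟨pK, hpK⟩ := CVPqProg.exists_pK hm hpm
  obtain ⟨pcoin, hcoin⟩ := CVPqProg.exists_pcoin q m a pc hq hm hpm ha pK
  obtain ⟨manuf, hmanuf, hmspec⟩ := CVPqProg.exists_manuf q m a samp pc pK hq hm hpm ha hsamp
  obtain ⟨post, hpost, hpspec⟩ := CVPqProg.exists_post q α m a hαa samp pc pK hq hm hpm ha hsamp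
  exact ⟨⟨pK, pcoin, manuf, hmanuf, post, fun Pc _ => hpost Pc, hpK, hcoin,
    fun I hI ρ k t P w hP j c _ => hmspec I hI ρ k t P w hP j (hpK I ρ k t P w) c, hpspec⟩⟩

end Regev2009

/-! ### A_plumb proved; the quantum step and `pqc.S19` from `{A_q14}` -/

section Holds

open _root_.Computability Literature.Computability.Complexity

variable (q : ℕ → ℕ) [∀ n, NeZero (q n)] (α : ℕ → ℝ)

/-- **Regev 2009, Lemma 3.11 — the TM plumbing of the `CVP_q` procedure is a theorem** (A_plumb
discharged): for every polynomially bounded `m`, polynomial-time parameters `q, m, α = a ∈ ℚ`, every `FP`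
coin sampler and every uniform quantum circuit family there is ONE polynomial-time oracle machine whose
kernel on the query is exactly the `CVP_q` law (negligible slack `0`).
[cite: RegevLWE2009, Lemma 3.11 (p. 18, proof); BennettBernsteinBrassardVazirani1997, Thm. 4.14] -/
theorem regev2009_lemma_3_11_cvpqPlumbing_holds : regev2009_lemma_3_11_cvpqPlumbing q α :=
  regev2009_lemma_3_11_cvpqPlumbing_of_programs q α fun m hpm hqm a hαa ha samp pc hsamp W =>
    Regev2009.cvpqPrograms_nonempty q α m hpm hqm a hαa ha samp pc hsamp W

/-- **Regev 2009, Lemma 3.11 — the classical half of the quantum step is a theorem outright** (A_cvpqM: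
coin sampler A_gsamp and plumbing A_plumb both proved). [cite: RegevLWE2009, Lemma 3.11 (p. 18)] -/
theorem regev2009_lemma_3_11_cvpqMachine_holds : regev2009_lemma_3_11_cvpqMachine q α :=
  regev2009_lemma_3_11_cvpqMachine_of_plumbing q α (regev2009_lemma_3_11_cvpqPlumbing_holds q α)

/-- **Regev 2009, Theorem 3.1 (SIVP form) from `{A_q14}` alone**: the worst-case-SIVP-to-LWE quantum
reduction follows from the uniform quantum circuit family of Lemma 3.14.
[cite: RegevLWE2009, Theorem 3.1 (p. 13), Lemma 3.11 (p. 18), Lemma 3.14 (p. 20)] -/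
theorem regev_lwe_to_sivp_quantum_holds_of_stepFamily (m : ℕ → ℕ) (hQ : regev2009_lemma_3_14_stepFamily q α) :
    regev_lwe_to_sivp_quantum q α m :=
  regev_lwe_to_sivp_quantum_holds_of_plumbing_of_step q α m (regev2009_lemma_3_11_cvpqPlumbing_holds q α) hQ

/-- **Regev 2009, Theorem 3.1 (GapSVP form) from `{A_q14}` alone**.
[cite: RegevLWE2009, Theorem 3.1 (p. 13), Lemma 3.14 (p. 20), Lemma 3.20 (p. 22)] -/
theorem regev_lwe_to_gapSVP_quantum_holds_of_stepFamily (m : ℕ → ℕ) (hQ : regev2009_lemma_3_14_stepFamily q α) :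
    regev_lwe_to_gapSVP_quantum q α m :=
  regev_lwe_to_gapSVP_quantum_holds_of_plumbing_of_step q α m (regev2009_lemma_3_11_cvpqPlumbing_holds q α) hQ

end Holds

end Literature.Computability.Cryptography
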